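import Literature.NumberTheory.Transcendental.RoySmallValueEstimatesAlgPointProofs
import Literature.NumberTheory.Transcendental.RoySmallValueEstimatesLiouvilleProofs
import HarnessLib

/-!
# Small value estimates at rational translates (Nguyen–Roy 2016) — proofs, XVII: Proposition 12 for points, Lemma 11, positivity

Seventeenth proofs file towards `Literature.NumberTheory.Transcendental.nguyenRoy2016_thm_1` (Nguyen–Roy,
IJNT 12 (2016) = arXiv:1412.5163). Everything here is PROVED; no named facts. With the algebraic
points `AlgPt` of file XVI as the `V` of `NguyenRoy.EndgameData` (`pts = conj`, `deg = #conj`,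
height `ht P = deg P · h_abs(P)`), this file discharges three of its fields:

* **Proposition 12 for one pair of distinct points** (`liouville_conj`): for conjugates
  `q ∈ conj P`, `q' ∈ conj P'` with `q ≠ q'`,
  `dist(q, q') ≥ exp(−(log 2 · deg P deg P' + deg P · ht P' + deg P' · ht P))`.
  Proof: put coordinates of `q, q'` in the compositum `L ⊆ ℂ` of the two embedded fields
  (`[L:ℚ] ≤ deg P deg P'`), apply the tree's Liouville inequality
  `NguyenRoy.neg_logHeight_le_sum_log_projDist` (`−h_L(γ) − h_L(δ) − [L:ℚ] log 2 ≤ log dist`) and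
  `h_L(γ) = [L:ℚ] h_abs(q) = [L:ℚ] h_abs(P)` (files XV–XVI). (The paper, with Chow-form heights,
  has `c₁₂ = 7`; with `ht = deg · h_abs` the constant is `log 2`.)
* **Lemma 11** (`ht_tauA_le`): `ht(τⁱP) ≤ ht P + c₄ |i| deg P` with
  `c₄ = log 3 + 2 c(r,s)` (`tauHtConst`, file XIV), from `logHeight_tauVecK_le` and
  `deg τⁱP = deg P`.
* **Positivity** (`isAlgebraic_of_isAlgPt`, `not_isAlgPt_gamP`, `pdist_pos_of_mem_conj_gamP`): if
  `(ξ, η) ∉ ℚ̄ × ℚ̄` then no `γ_i = (1 : ξ + ir : ηsⁱ)` is algebraic, so `dist(α, γ_i) > 0` for every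
  algebraic `α` (§6: "Since (ξ, η) ∉ ℚ̄ × ℚ̄, …").

## References

* [NguyenRoy2016] N. A. V. Nguyen, D. Roy, IJNT 12 (2016) 1273–1293 = arXiv:1412.5163, §4,
  Lemma 11, Proposition 12; §6 (first paragraph).
-/

noncomputable section

open Height Module Matrix Finset
open Literature.NumberTheory.Transcendental.Nesterenko
open scoped Classical

namespace Literature.NumberTheory.Transcendental

namespace NguyenRoy

/-! ### Wedge zero means equal points -/

/-- `γ ∧ δ = 0` forces `[γ] = [δ]`. [folklore] -/
theorem mk_eq_mk_of_wedge_eq_zero {v w : V3} (hv : v ≠ 0) (hw : w ≠ 0) (h : wedge v w = 0) :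
    Projectivization.mk ℂ v hv = Projectivization.mk ℂ w hw := by
  apply mk_eq_mk_of_minors_eq_zero hv hw
  intro i j
  rcases lt_trichotomy i j with hij | rfl | hji
  · have := congrFun h ⟨(i, j), hij⟩
    simp only [wedge, Pi.zero_apply] at this
    exact sub_eq_zero.mp this
  · rfl
  · have := congrFun h ⟨(j, i), hji⟩
    simp only [wedge, Pi.zero_apply] at this
    exact (sub_eq_zero.mp this).symm

/-- The rank of the embedded image of a number field equals its degree. [folklore] -/
theorem finrank_fieldRange {E : Type*} [Field E] [Algebra ℚ E] (f : E →ₐ[ℚ] ℂ) :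
    finrank ℚ f.fieldRange = finrank ℚ E := by
  change finrank ℚ f.fieldRange.toSubalgebra = _
  rw [AlgHom.fieldRange_toSubalgebra]
  exact (AlgEquiv.ofInjectiveField f).toLinearEquiv.finrank_eq.symm

namespace AlgPt

/-! ### Proposition 12 for one pair of distinct points -/

/-- The height `ht P = deg P · h_abs(P)` (`= ∑_{q ∈ conj P} h_abs(q)`) of the zero-dimensional
`ℚ`-subvariety through `P`. [cite: NguyenRoy2016, §4 (h(Z), compared with deg(Z) h_abs(α))] -/
def ht (P : AlgPt) : ℝ := P.deg * habs P.1

/-- `0 ≤ ht`. [folklore] -/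
theorem ht_nonneg (P : AlgPt) : 0 ≤ P.ht := mul_nonneg (Nat.cast_nonneg _) (habs_nonneg _)

/-- **Proposition 12 (Liouville) for one pair of distinct points.** For `q ∈ conj P`,
`q' ∈ conj P'`, `q ≠ q'`:
`exp(−(log 2 · deg P · deg P' + deg P · ht P' + deg P' · ht P)) ≤ dist(q, q')`.
[cite: NguyenRoy2016, Proposition 12] -/
theorem liouville_conj (P P' : AlgPt) {q q' : PPt} (hq : q ∈ P.conj) (hq' : q' ∈ P'.conj)
    (hne : q ≠ q') :
    Real.exp (-(Real.log 2 * P.deg * P'.deg + P.deg * P'.ht + P'.deg * P.ht)) ≤ pdist q q' := by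
  obtain ⟨φ, -, rfl⟩ := Finset.mem_image.mp hq
  obtain ⟨φ', -, rfl⟩ := Finset.mem_image.mp hq'
  -- the compositum of the two embedded fields
  set Q : NFPres (P.embPt φ) := P.presConj φ with hQ
  set Q' : NFPres (P'.embPt φ') := P'.presConj φ' with hQ'
  let L : IntermediateField ℚ ℂ := Q.E ⊔ Q'.E
  haveI : FiniteDimensional ℚ L := IntermediateField.finiteDimensional_sup Q.E Q'.E
  haveI : NumberField L := NFPres.numberField_of_intermediateField L
  have hmem : ∀ x, φ x ∈ L := fun x => (le_sup_left : Q.E ≤ L) (Q.mem_E x)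
  have hmem' : ∀ x, φ' x ∈ L := fun x => (le_sup_right : Q'.E ≤ L) (Q'.mem_E x)
  let f : Kp P.1 →+* L := φ.toRingHom.codRestrict L hmem
  let f' : Kp P'.1 →+* L := φ'.toRingHom.codRestrict L hmem'
  set γ : Fin 3 → L := fun j => f (ap P.1 j) with hγ
  set δ : Fin 3 → L := fun j => f' (ap P'.1 j) with hδ
  have hγv : ∀ j, ((γ j : L) : ℂ) = φ (ap P.1 j) := fun j => rfl
  have hδv : ∀ j, ((δ j : L) : ℂ) = φ' (ap P'.1 j) := fun j => rfl
  let val : L →+* ℂ := (algebraMap L ℂ)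
  have hvalγ : (val ∘ γ) = fun j => φ (ap P.1 j) := funext fun j => by simp [val, hγv]
  have hvalδ : (val ∘ δ) = fun j => φ' (ap P'.1 j) := funext fun j => by simp [val, hδv]
  have hγ0 : (val ∘ γ) ≠ 0 := by rw [hvalγ]; exact map_ap_ne_zero φ.toRingHom
  have hδ0 : (val ∘ δ) ≠ 0 := by rw [hvalδ]; exact map_ap_ne_zero φ'.toRingHom
  -- the distance is positive and computed by `γ, δ`
  have hdist : pdist (P.embPt φ) (P'.embPt φ') = projDist (val ∘ γ) (val ∘ δ) := by
    have e1 : P.embPt φ = Projectivization.mk ℂ (val ∘ γ) hγ0 := mk_congr _ _ hvalγ.symm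
    have e2 : P'.embPt φ' = Projectivization.mk ℂ (val ∘ δ) hδ0 := mk_congr _ _ hvalδ.symm
    rw [e1, e2, pdist_mk]
  have hpos : 0 < pdist (P.embPt φ) (P'.embPt φ') := pdist_pos_of_ne hne
  -- `γ ∧ δ ≠ 0`
  have hw : wedge γ δ ≠ 0 := by
    intro hw0
    apply hne
    have hw' : wedge (val ∘ γ) (val ∘ δ) = 0 := by
      funext p
      rw [← map_wedge val γ δ p, hw0, Pi.zero_apply, map_zero, Pi.zero_apply]
    have := mk_eq_mk_of_wedge_eq_zero hγ0 hδ0 hw'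
    rwa [← mk_congr _ _ hvalγ.symm, ← mk_congr _ _ hvalδ.symm] at this
  -- Liouville in `L`
  have hL := neg_logHeight_le_sum_log_projDist hw {val} (fun σ hσ => by
    rw [Finset.mem_singleton] at hσ
    subst hσ
    rw [← hdist]
    exact hpos.ne')
  rw [Finset.sum_singleton, ← hdist] at hL
  -- the heights relative to `L`
  have hhγ : logHeight γ = finrank ℚ L * habs P.1 := by
    have h1 : habs (P.embPt φ) = logHeight γ / finrank ℚ L :=
      habs_eq (⟨L, val, γ, hγ0, (mk_congr _ _ hvalγ).trans rfl⟩ : NFPres _)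
    rw [P.habs_of_mem_conj hq] at h1
    have hpos' : (0 : ℝ) < finrank ℚ L := by exact_mod_cast Module.finrank_pos
    field_simp at h1
    linarith
  have hhδ : logHeight δ = finrank ℚ L * habs P'.1 := by
    have h1 : habs (P'.embPt φ') = logHeight δ / finrank ℚ L :=
      habs_eq (⟨L, val, δ, hδ0, (mk_congr _ _ hvalδ).trans rfl⟩ : NFPres _)
    rw [P'.habs_of_mem_conj hq'] at h1
    have hpos' : (0 : ℝ) < finrank ℚ L := by exact_mod_cast Module.finrank_pos
    field_simp at h1
    linarith
  -- `[L:ℚ] ≤ deg P · deg P'`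
  have hdegL : (finrank ℚ L : ℝ) ≤ P.deg * P'.deg := by
    have h1 := IntermediateField.finrank_sup_le Q.E Q'.E
    have h2 : finrank ℚ Q.E = P.deg := finrank_fieldRange _
    have h3 : finrank ℚ Q'.E = P'.deg := finrank_fieldRange _
    rw [h2, h3] at h1
    exact_mod_cast h1
  -- conclude
  rw [← Real.le_log_iff_exp_le hpos]
  have hlog2 : 0 ≤ Real.log 2 := Real.log_nonneg one_le_two
  have hP0 := habs_nonneg P.1
  have hP'0 := habs_nonneg P'.1
  have e1 : (finrank ℚ L : ℝ) * habs P.1 ≤ P'.deg * P.ht := by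
    rw [ht, ← mul_assoc, mul_comm (P'.deg : ℝ)]
    exact mul_le_mul_of_nonneg_right hdegL hP0
  have e2 : (finrank ℚ L : ℝ) * habs P'.1 ≤ P.deg * P'.ht := by
    rw [ht, ← mul_assoc]
    exact mul_le_mul_of_nonneg_right hdegL hP'0
  have e3 : (finrank ℚ L : ℝ) * Real.log 2 ≤ Real.log 2 * P.deg * P'.deg := by
    rw [mul_comm, mul_assoc]
    exact mul_le_mul_of_nonneg_left hdegL hlog2
  rw [hhγ, hhδ] at hL
  linarith

/-! ### Lemma 11: the height of a translate -/

section translate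

variable (r : ℚ) {s : ℚ}

/-- The constant `c₄ = log 3 + 2 c(r, s)` of Lemma 11. [cite: NguyenRoy2016, Lemma 11] -/
def c4 (r s : ℚ) : ℝ := Real.log 3 + 2 * tauHtConst r s

/-- `0 ≤ c(r, s)` for `s ≠ 0`. [folklore] -/
theorem tauHtConst_nonneg (hs : s ≠ 0) : 0 ≤ tauHtConst r s := by
  obtain ⟨h1, h2, h3⟩ := tauHtConst_parts_nonneg r s hs
  unfold tauHtConst
  linarith

/-- `0 ≤ c₄`. [folklore] -/
theorem c4_nonneg (hs : s ≠ 0) : 0 ≤ c4 r s := by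
  have := tauHtConst_nonneg r hs
  have : 0 ≤ Real.log 3 := Real.log_nonneg (by norm_num)
  unfold c4; linarith

/-- `h_abs(τⁱP) ≤ h_abs(P) + log 3 + c(|i| + 1)`. [cite: NguyenRoy2016, Lemma 11 (proof)] -/
theorem habs_tauA_le (P : AlgPt) (hs : s ≠ 0) (i : ℤ) :
    habs (P.tauA r hs i).1 ≤ habs P.1 + (Real.log 3 + tauHtConst r s * (|(i : ℝ)| + 1)) := by
  rw [P.tauA_val r hs i, habs_eq (P.presTau r hs i), P.habs_eq_logHeight_ap, NFPres.habs]
  change logHeight (tauVecK r s i (ap P.1)) / (finrank ℚ (Kp P.1) : ℝ) ≤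
    logHeight (ap P.1) / (P.deg : ℝ) + _
  have h := logHeight_tauVecK_le r s hs i (ap P.1)
  rw [NumberField.totalWeight_eq_finrank] at h
  have hd : (0 : ℝ) < P.deg := by exact_mod_cast P.one_le_deg
  rw [deg] at hd ⊢
  rw [div_le_iff₀ hd, add_mul, div_mul_cancel₀ _ hd.ne']
  linarith

/-- **Lemma 11** (height of a translate): `ht(τⁱP) ≤ ht P + c₄ |i| deg P`.
[cite: NguyenRoy2016, Lemma 11] -/
theorem ht_tauA_le (P : AlgPt) (hs : s ≠ 0) (i : ℤ) :
    (P.tauA r hs i).ht ≤ P.ht + c4 r s * |(i : ℝ)| * P.deg := by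
  rcases eq_or_ne i 0 with rfl | hi
  · rw [tauA_zero]; simp
  have h1 := P.habs_tauA_le r hs i
  have hdeg : ((P.tauA r hs i).deg : ℝ) = P.deg := by exact_mod_cast P.deg_tauA r hs i
  have hd0 : (0 : ℝ) ≤ P.deg := Nat.cast_nonneg _
  have hi1 : (1 : ℝ) ≤ |(i : ℝ)| := by
    rw [← Int.cast_abs]; exact_mod_cast Int.one_le_abs hi
  have hc := tauHtConst_nonneg r hs
  have hl3 : 0 ≤ Real.log 3 := Real.log_nonneg (by norm_num)
  have key : Real.log 3 + tauHtConst r s * (|(i : ℝ)| + 1) ≤ c4 r s * |(i : ℝ)| := by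
    unfold c4; nlinarith
  rw [ht, ht, hdeg]
  calc (P.deg : ℝ) * habs (P.tauA r hs i).1
      ≤ P.deg * (habs P.1 + (Real.log 3 + tauHtConst r s * (|(i : ℝ)| + 1))) :=
        mul_le_mul_of_nonneg_left h1 hd0
    _ ≤ P.deg * (habs P.1 + c4 r s * |(i : ℝ)|) := by
        apply mul_le_mul_of_nonneg_left _ hd0; linarith
    _ = P.deg * habs P.1 + c4 r s * |(i : ℝ)| * P.deg := by ring

end translate

end AlgPt

/-! ### Positivity: the points `γ_i` are not algebraic -/

/-- An algebraic point `(1 : x : y)` has algebraic affine coordinates. [cite: NguyenRoy2016, §6] -/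
theorem isAlgebraic_of_isAlgPt {x y : ℂ} (hne : (![1, x, y] : V3) ≠ 0)
    (h : IsAlgPt (Projectivization.mk ℂ ![1, x, y] hne)) : IsAlgebraic ℚ x ∧ IsAlgebraic ℚ y := by
  obtain ⟨P⟩ := h
  obtain ⟨c, hc⟩ := (Projectivization.mk_eq_mk_iff' ℂ _ _ P.ne_zero hne).mp P.mk_eq
  -- `hc : c • (1, x, y) = ι ∘ a`
  have h0 : c = P.ι (P.a 0) := by have := congrFun hc 0; simpa using this
  have h1 : c * x = P.ι (P.a 1) := by have := congrFun hc 1; simpa using this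
  have h2 : c * y = P.ι (P.a 2) := by have := congrFun hc 2; simpa using this
  have hc0 : c ≠ 0 := by
    rintro rfl
    apply P.ne_zero
    rw [← hc, zero_smul]
  have ha0 : P.a 0 ≠ 0 := fun h => hc0 (by rw [h0, h, map_zero])
  have hx : x = P.ι (P.a 1 / P.a 0) := by
    rw [map_div₀, ← h1, ← h0]; field_simp
  have hy : y = P.ι (P.a 2 / P.a 0) := by
    rw [map_div₀, ← h2, ← h0]; field_simp
  have alg : ∀ z : P.K, IsAlgebraic ℚ (P.ι z) := fun z =>
    (Algebra.IsAlgebraic.isAlgebraic z).algHom P.ι.toRatAlgHom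
  exact ⟨hx ▸ alg _, hy ▸ alg _⟩

section gam

variable (ξ η : ℂ) (r : ℚ) {s : ℚ}

/-- If `(ξ, η) ∉ ℚ̄ × ℚ̄`, no `γ_i = (1 : ξ + ir : ηsⁱ)` is algebraic. [cite: NguyenRoy2016, §6] -/
theorem not_isAlgPt_gamP (hs : s ≠ 0) (hη : η ≠ 0) (hξη : ¬ (IsAlgebraic ℚ ξ ∧ IsAlgebraic ℚ η))
    (i : ℤ) : ¬ IsAlgPt (gamP ξ η (r : ℂ) (s : ℂ) i) := by
  intro h
  apply hξη
  have hsC : (s : ℂ) ≠ 0 := by exact_mod_cast hs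
  have h' := isAlgebraic_of_isAlgPt (gvec_ne_zero ξ η (r : ℂ) (s : ℂ) i) h
  obtain ⟨h1, h2⟩ := h'
  have hrat : ∀ q : ℚ, IsAlgebraic ℚ (q : ℂ) := fun q => isAlgebraic_algebraMap q
  constructor
  · have : ξ = (ξ + (i : ℂ) * (r : ℂ)) - (((i : ℚ) * r : ℚ) : ℂ) := by push_cast; ring
    rw [this]
    exact h1.sub (hrat _)
  · have : η = (η * (s : ℂ) ^ i) * (((s ^ i)⁻¹ : ℚ) : ℂ) := by
      push_cast; field_simp
    rw [this]
    exact h2.mul (hrat _)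

/-- **Positivity** (`dist_γ_pos`): if `(ξ, η) ∉ ℚ̄ × ℚ̄`, every conjugate of an algebraic point is
at positive projective distance from every `γ_i`. [cite: NguyenRoy2016, §6 (first paragraph)] -/
theorem pdist_pos_of_mem_conj_gamP (hs : s ≠ 0) (hη : η ≠ 0)
    (hξη : ¬ (IsAlgebraic ℚ ξ ∧ IsAlgebraic ℚ η)) (P : AlgPt) {q : PPt} (hq : q ∈ P.conj)
    (i : ℤ) : 0 < pdist q (gamP ξ η (r : ℂ) (s : ℂ) i) := by
  refine pdist_pos_of_ne fun h => not_isAlgPt_gamP ξ η r hs hη hξη i ?_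
  rw [← h]
  exact P.isAlgPt_of_mem_conj hq

end gam

end NguyenRoy

end Literature.NumberTheory.Transcendental

end
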